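import Literature.Probability.Percolation.TriLoopWinding
import HarnessLib

/-!
# Winding numbers of closed lattice polylines: far points and transport along paths

Topic `Literature/Probability/Percolation`; family `crit-perc`. Three additions to the
winding-number bookkeeping of `TriLoopWinding.lean` (the substitute for the Jordan curve theorem
in the colour-switching arguments, Bollobás–Riordan, *Percolation* (2006), Ch. 7, Claims 7 and 9,
pp. 173–175), used by the colour-exchange flip in an annulus (`ArmPatternsFourArmFlip*.lean`):

* `latWind_eq_zero_of_lt_functional` — **a closed lattice polyline does not wind about a point
  separated from all its vertices by a line** (`a·Re + b·Im ≤ m` at the vertices, `> m` at the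
  point): the loop seen from the point stays in an open half-plane, where `z ↦ z` has a
  continuous logarithm, so `wind = 0` (`wind_comp_eq_zero_of_hasLogOn`);
  `latWind_triEmbed_eq_zero_of_triNorm_lt` — in particular a polyline through sites of graph
  norm `≤ M` has winding number `0` about every site of graph norm `> M` (the hexagon
  `{|·|_𝕋 ≤ M}` is cut out by the six lines `±x₀, ±x₁, ±(x₀ + x₁) = M`);
* `latWind_triEmbed_eq_of_adj` / `latWind_triEmbed_eq_of_walk` / `…_of_pathIn` — **moving along
  a bond, a path, of sites none of which is a vertex of the polyline keeps the winding number**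
  (through the face to the left of each bond, `latWind_hexCenter_eq_latWind_faceVertex`).

Everything is folklore (argument principle bookkeeping).

## References

* B. Bollobás, O. Riordan, *Percolation*, Cambridge University Press (2006), Ch. 7 §7.2.3,
  proof of Claims 7 and 9, pp. 173–175 [BollobasRiordan2006].
* L. V. Ahlfors, *Complex Analysis*, 3rd ed. (1979), §4.2.1.

## Mathlib / tree

Mathlib: `Complex.log`, `Complex.slitPlane`, `Complex.exp_log`, `ContinuousAt.clog`,
`segment_subset_iff`, `Convex`. Tree: `latWind`, `latPieces`, `latPath`, `range_latPath`,
`latWind_hexCenter_eq_latWind_faceVertex` (`TriLoopWinding.lean`); `wind`,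
`wind_comp_eq_zero_of_hasLogOn`, `HasLogOn` (`Topology/PlaneTopology/WindingNumber.lean`);
`leftFace`, `exists_eq_faceVertex_of_adj` (`TriDiscShelling.lean`); `triEmbed_re`, `triEmbed_im`
(`OneArmLSW.lean`); `triNorm_eq_of_apply_eq`; `PathIn.exists_walk`.
-/

noncomputable section

open Complex Set Literature.Topology.PlaneTopology Literature.Combinatorics.Enumerative

namespace Literature.Probability.Percolation

open LatticeModels

/-! ### A continuous logarithm on an open half-plane through the origin -/

/-- On the open half-plane `{z | a·Re z + b·Im z < 0}` (`(a, b) ≠ 0`) the identity has a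
continuous logarithm: with `d = a - b i` one has `a·Re z + b·Im z = Re (z d)`, so `-(z d)` lies in
the slit plane there. [folklore] -/
theorem hasLogOn_id_halfPlane {a b : ℝ} (hab : a ≠ 0 ∨ b ≠ 0) :
    HasLogOn (fun z : ℂ => z) {z : ℂ | a * z.re + b * z.im < 0} := by
  set d : ℂ := ⟨a, -b⟩ with hd
  have hd0 : d ≠ 0 := by
    intro h
    have h1 := congrArg Complex.re h
    have h2 := congrArg Complex.im h
    simp [hd] at h1 h2
    rcases hab with h | h
    · exact h h1
    · exact h h2
  have hre : ∀ z : ℂ, (z * d).re = a * z.re + b * z.im := by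
    intro z; simp [hd, Complex.mul_re]; ring
  have hslit : ∀ z : ℂ, a * z.re + b * z.im < 0 → -(z * d) ∈ Complex.slitPlane := by
    intro z hz
    left
    rw [Complex.neg_re, hre]
    linarith
  refine ⟨fun z => Complex.log (-(z * d)) - Complex.log (-d), ?_, ?_⟩
  · apply ContinuousOn.sub _ continuousOn_const
    intro z hz
    exact ((continuous_id.mul continuous_const).neg.continuousAt.clog (hslit z hz)).continuousWithinAt
  · intro z hz
    have hzd : -(z * d) ≠ 0 := by
      intro h0
      have := hslit z hz
      rw [h0] at this
      exact Complex.slitPlane_ne_zero this rfl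
    rw [Complex.exp_sub, Complex.exp_log hzd, Complex.exp_log (neg_ne_zero.2 hd0)]
    field_simp

/-! ### Far points: no winding about a point beyond a supporting line -/

/-- **A closed lattice polyline does not wind about a point separated from its vertices by a
line**: if `a·Re + b·Im ≤ m` at (the embeddings of) all the vertices `v₀ :: l` and
`a·Re p + b·Im p > m`, then `latWind v₀ l p = 0`. [folklore] -/
theorem latWind_eq_zero_of_lt_functional {v₀ : Site 2} {l : List (Site 2)} {a b m : ℝ}
    (hC : ∀ v ∈ v₀ :: l, a * (triEmbed v).re + b * (triEmbed v).im ≤ m) {p : ℂ} (hp : m < a * p.re + b * p.im) :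
    latWind v₀ l p = 0 := by
  have hab : a ≠ 0 ∨ b ≠ 0 := by
    by_contra h
    push Not at h
    have := hC v₀ (by simp)
    rw [h.1, h.2] at this hp
    simp at this hp
    linarith
  set φ : ℂ → ℝ := fun z => a * z.re + b * z.im with hφ
  -- every vertex, hence every point of the trace, has `φ ≤ m`
  have hvert : ∀ q ∈ latPieces v₀ l, φ (triEmbed q.1) ≤ m ∧ φ (triEmbed q.2) ≤ m := by
    intro q hq
    rw [latPieces_eq_consecPairs] at hq
    obtain ⟨h1, h2⟩ := mem_of_mem_consecPairs hq
    have hmem : ∀ x ∈ v₀ :: l ++ [v₀], x ∈ v₀ :: l := by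
      intro x hx
      rw [List.cons_append, List.mem_cons, List.mem_append, List.mem_cons] at hx
      rcases hx with rfl | hx | rfl | hx
      · simp
      · exact List.mem_cons_of_mem _ hx
      · simp
      · simp at hx
    exact ⟨hC _ (hmem _ h1), hC _ (hmem _ h2)⟩
  have hconv : Convex ℝ {z : ℂ | φ z ≤ m} := by
    have : {z : ℂ | φ z ≤ m} = {z : ℂ | (a • Complex.reLm + b • Complex.imLm) z ≤ m} := by
      ext z; simp [hφ]
    rw [this]
    exact convex_halfSpace_le (LinearMap.isLinear _) m
  have htrace : ∀ z ∈ Set.range (latPath v₀ l), φ z ≤ m := by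
    intro z hz
    rw [range_latPath] at hz
    obtain ⟨q, hq, hz⟩ := Set.mem_iUnion₂.1 hz
    obtain ⟨h1, h2⟩ := hvert q hq
    exact hconv.segment_subset h1 h2 hz
  -- the loop seen from `p` stays in the half-plane `φ < 0`
  unfold latWind
  set γ : ℝ → ℂ := fun t => (latPath v₀ l).extend t with hγ
  have hlin : ∀ z : ℂ, φ (z - p) = φ z - φ p := by intro z; simp [hφ]; ring
  have key := wind_comp_eq_zero_of_hasLogOn (F := fun z : ℂ => z) (S := {z : ℂ | a * z.re + b * z.im < 0})
    (γ := fun t => γ t - p) (hasLogOn_id_halfPlane hab)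
    (((latPath v₀ l).continuous_extend.continuousOn).sub continuousOn_const) ?_ ?_
  · exact key
  · intro t ht
    change φ (γ t - p) < 0
    rw [hlin]
    have : γ t ∈ Set.range (latPath v₀ l) := by
      rw [hγ]; simp only
      rw [Path.extend_apply _ ht]
      exact ⟨_, rfl⟩
    have := htrace _ this
    change m < φ p at hp
    linarith
  · rw [hγ]; simp only
    rw [Path.extend_zero, Path.extend_one, latPath_end]

/-- **A polyline through sites of graph norm `≤ M` does not wind about a site of graph norm
`> M`.** The hexagon `{|·|_𝕋 ≤ M}` is the intersection of the six half-planes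
`±x₀, ±x₁, ±(x₀+x₁) ≤ M`, each a half-plane of the embedding (`x₀ = Re - Im/√3`,
`x₁ = 2 Im/√3`), and a site of larger norm violates one of them. [folklore] -/
theorem latWind_triEmbed_eq_zero_of_triNorm_lt {v₀ : Site 2} {l : List (Site 2)} {M : ℤ}
    (hC : ∀ v ∈ v₀ :: l, triNorm v ≤ M) {z : Site 2} (hz : M < triNorm z) :
    latWind v₀ l (triEmbed z) = 0 := by
  have h3 : (0 : ℝ) < Real.sqrt 3 := Real.sqrt_pos.2 (by norm_num)
  -- the six functionals, as `a·Re + b·Im` up to the positive factor `√3`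
  -- `√3·x₀ = √3 Re - Im`, `√3·x₁ = 2 Im`, `√3·(x₀ + x₁) = √3 Re + Im`
  have f0 : ∀ v : Site 2, Real.sqrt 3 * (triEmbed v).re + (-1) * (triEmbed v).im = Real.sqrt 3 * (v 0 : ℝ) := by
    intro v; rw [triEmbed_re, triEmbed_im]; ring
  have f1 : ∀ v : Site 2, 0 * (triEmbed v).re + 2 * (triEmbed v).im = Real.sqrt 3 * (v 1 : ℝ) := by
    intro v; rw [triEmbed_im]; ring
  have f2 : ∀ v : Site 2, Real.sqrt 3 * (triEmbed v).re + 1 * (triEmbed v).im = Real.sqrt 3 * ((v 0 : ℝ) + v 1) := by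
    intro v; rw [triEmbed_re, triEmbed_im]; ring
  have hCo : ∀ v ∈ v₀ :: l, (v 0 : ℝ) ≤ M ∧ -(v 0 : ℝ) ≤ M ∧ (v 1 : ℝ) ≤ M ∧ -(v 1 : ℝ) ≤ M ∧
      (v 0 : ℝ) + v 1 ≤ M ∧ -((v 0 : ℝ) + v 1) ≤ M := by
    intro v hv
    have h := hC v hv
    have hn := triNorm_eq_of_apply_eq (y := v) rfl rfl
    refine ⟨?_, ?_, ?_, ?_, ?_, ?_⟩ <;> exact_mod_cast (show _ from by omega)
  have hzn := triNorm_eq_of_apply_eq (y := z) rfl rfl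
  have hz6 : (M : ℝ) < z 0 ∨ (M : ℝ) < -(z 0 : ℝ) ∨ (M : ℝ) < z 1 ∨ (M : ℝ) < -(z 1 : ℝ) ∨
      (M : ℝ) < (z 0 : ℝ) + z 1 ∨ (M : ℝ) < -((z 0 : ℝ) + z 1) := by
    have : M < z 0 ∨ M < -z 0 ∨ M < z 1 ∨ M < -z 1 ∨ M < z 0 + z 1 ∨ M < -(z 0 + z 1) := by omega
    rcases this with h | h | h | h | h | h
    · exact Or.inl (by exact_mod_cast h)
    · exact Or.inr (Or.inl (by exact_mod_cast h))
    · exact Or.inr (Or.inr (Or.inl (by exact_mod_cast h)))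
    · exact Or.inr (Or.inr (Or.inr (Or.inl (by exact_mod_cast h))))
    · exact Or.inr (Or.inr (Or.inr (Or.inr (Or.inl (by exact_mod_cast h)))))
    · exact Or.inr (Or.inr (Or.inr (Or.inr (Or.inr (by exact_mod_cast h)))))
  have smul_le : ∀ {x y : ℝ}, x ≤ y → Real.sqrt 3 * x ≤ Real.sqrt 3 * y := fun h => mul_le_mul_of_nonneg_left h h3.le
  have smul_lt : ∀ {x y : ℝ}, x < y → Real.sqrt 3 * x < Real.sqrt 3 * y := fun h => mul_lt_mul_of_pos_left h h3
  rcases hz6 with h | h | h | h | h | h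
  · refine latWind_eq_zero_of_lt_functional (a := Real.sqrt 3) (b := -1) (m := Real.sqrt 3 * M) (fun v hv => ?_) ?_
    · rw [f0]; exact smul_le (hCo v hv).1
    · rw [f0]; exact smul_lt h
  · refine latWind_eq_zero_of_lt_functional (a := -Real.sqrt 3) (b := 1) (m := Real.sqrt 3 * M) (fun v hv => ?_) ?_
    · have := f0 v; have h' := smul_le (hCo v hv).2.1; linarith
    · have := f0 z; have h' := smul_lt h; linarith
  · refine latWind_eq_zero_of_lt_functional (a := 0) (b := 2) (m := Real.sqrt 3 * M) (fun v hv => ?_) ?_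
    · rw [f1]; exact smul_le (hCo v hv).2.2.1
    · rw [f1]; exact smul_lt h
  · refine latWind_eq_zero_of_lt_functional (a := 0) (b := -2) (m := Real.sqrt 3 * M) (fun v hv => ?_) ?_
    · have := f1 v; have h' := smul_le (hCo v hv).2.2.2.1; linarith
    · have := f1 z; have h' := smul_lt h; linarith
  · refine latWind_eq_zero_of_lt_functional (a := Real.sqrt 3) (b := 1) (m := Real.sqrt 3 * M) (fun v hv => ?_) ?_
    · rw [f2]; exact smul_le (hCo v hv).2.2.2.2.1
    · rw [f2]; exact smul_lt h
  · refine latWind_eq_zero_of_lt_functional (a := -Real.sqrt 3) (b := -1) (m := Real.sqrt 3 * M) (fun v hv => ?_) ?_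
    · have := f2 v; have h' := smul_le (hCo v hv).2.2.2.2.2; linarith
    · have := f2 z; have h' := smul_lt h; linarith

/-! ### Transport along bonds and paths of sites off the polyline -/

/-- **Moving along a bond between two sites neither of which is a vertex of a piece keeps the
winding number** (both are vertices of the face to the left of the bond). [folklore] -/
theorem latWind_triEmbed_eq_of_adj {v₀ : Site 2} {l : List (Site 2)}
    (hadj : ∀ p ∈ latPieces v₀ l, p.1 = p.2 ∨ triGraph.Adj p.1 p.2) {x y : Site 2} (hxy : triGraph.Adj x y)
    (hx : ∀ p ∈ latPieces v₀ l, x ≠ p.1 ∧ x ≠ p.2) (hy : ∀ p ∈ latPieces v₀ l, y ≠ p.1 ∧ y ≠ p.2) :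
    latWind v₀ l (triEmbed x) = latWind v₀ l (triEmbed y) := by
  obtain ⟨j, hxj, hyj⟩ := exists_eq_faceVertex_of_adj hxy
  have e1 := latWind_hexCenter_eq_latWind_faceVertex hadj (F := leftFace x y) (v := j) (by rw [← hxj]; exact hx)
  have e2 := latWind_hexCenter_eq_latWind_faceVertex hadj (F := leftFace x y) (v := j + 1) (by rw [← hyj]; exact hy)
  rw [← hxj] at e1; rw [← hyj] at e2
  rw [← e1, e2]

/-- **Moving along a walk of sites none of which is a vertex of a piece keeps the winding
number** ("`P₃` cannot cross `C`", Bollobás–Riordan 2006, p. 175). [cite: BollobasRiordan2006, Ch. 7 proof of Claim 9 p. 175] -/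
theorem latWind_triEmbed_eq_of_walk {v₀ : Site 2} {l : List (Site 2)}
    (hadj : ∀ p ∈ latPieces v₀ l, p.1 = p.2 ∨ triGraph.Adj p.1 p.2) {x y : Site 2} (Q : triGraph.Walk x y)
    (hQ : ∀ z ∈ Q.support, ∀ p ∈ latPieces v₀ l, z ≠ p.1 ∧ z ≠ p.2) :
    latWind v₀ l (triEmbed x) = latWind v₀ l (triEmbed y) := by
  induction Q with
  | nil => rfl
  | cons h Q ih =>
    rename_i a b c
    rw [latWind_triEmbed_eq_of_adj hadj h (hQ a (by simp)) (hQ b (by simp))]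
    exact ih fun z hz => hQ z (List.mem_cons_of_mem _ hz)

/-- **Moving inside a set of sites avoiding the vertices of the pieces keeps the winding
number.** [cite: BollobasRiordan2006, Ch. 7 proof of Claim 9 p. 175] -/
theorem latWind_triEmbed_eq_of_pathIn {v₀ : Site 2} {l : List (Site 2)}
    (hadj : ∀ p ∈ latPieces v₀ l, p.1 = p.2 ∨ triGraph.Adj p.1 p.2) {S : Set (Site 2)}
    (hS : ∀ z ∈ S, ∀ p ∈ latPieces v₀ l, z ≠ p.1 ∧ z ≠ p.2) {x y : Site 2} (h : PathIn triGraph S x y) :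
    latWind v₀ l (triEmbed x) = latWind v₀ l (triEmbed y) := by
  obtain ⟨Q, hQ⟩ := h.exists_walk
  exact latWind_triEmbed_eq_of_walk hadj Q fun z hz => hS z (hQ z hz)

/-- **From a face to one of its vertices off the pieces** (restated with the vertex as a member
of `hexFaceVertices`). [folklore] -/
theorem latWind_hexCenter_eq_of_mem_hexFaceVertices {v₀ : Site 2} {l : List (Site 2)}
    (hadj : ∀ p ∈ latPieces v₀ l, p.1 = p.2 ∨ triGraph.Adj p.1 p.2) {F : HexVertex} {x : Site 2}
    (hx : x ∈ hexFaceVertices F) (hne : ∀ p ∈ latPieces v₀ l, x ≠ p.1 ∧ x ≠ p.2) :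
    latWind v₀ l (hexCenter F) = latWind v₀ l (triEmbed x) := by
  obtain ⟨j, rfl⟩ := mem_hexFaceVertices_iff_faceVertex.1 hx
  exact latWind_hexCenter_eq_latWind_faceVertex hadj hne

end Literature.Probability.Percolation

end
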